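import Literature.Analysis.FluidPDE.KatoLaiTimeRegularity
import Literature.Analysis.FunctionSpaces.TorusLerayHelmholtzProofs
import Literature.Analysis.Calculus.IteratedFDerivParametricIntegral
import HarnessLib

/-!
# Kato–Lai in the periodic cylinder: point evaluation of the physical field through `SymL2`

Analysis/FluidPDE support file for the energy-method construction of Euler flows in the
periodic cylinder (`Literature.Analysis.FluidPDE.KatoLai1984_periodicCylinderUniformExistence`):
the physical velocity `u(t, x) = Re ∑ₖ e_k(ξ(x)) Ĝₖ(t)`, `ξ(x)` the torus point of `x`, is the
pairing in `X = SymL2 (Fin 3)` of the level-`m` reading of the coefficients with an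
**evaluation element** depending smoothly on `x` (Grafakos 2014, Prop. 3.3.12: term-by-term
differentiation of Fourier series with polynomially decaying coefficients, here through Mathlib's
`contDiff_tsum` for series with values in the Hilbert space `X`):

* `pairCLM i k : ℂ →L[ℝ] X` — the two-mode element `z ↦ symSingle k (z • δᵢ)`, `‖·‖ ≤ 2`;
* `charFn L k x = e_{-k}(ξ(x))` — smooth on `ℝ³` with `‖Dʲ‖ ≤ (2π(1+|k|²) ‖a⁻¹‖)ʲ`;
* `evalElem L m i x = ½ ∑ₖ wt m k ⁻¹ • pairCLM i k (charFn L k x)` — **`C^n` in `x` for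
  `2n + 4 ≤ m`** (`contDiff_evalElem`), with coordinates `wt m l ⁻¹ e_{-l}(ξ(x)) δᵢ`;
* `physVel g ξ = Re ∑ₖ e_k(ξ) gₖ` — **the physical field** of an `L²`-level coefficient family
  (`physVel_toL2 : physVel (toL2 U) = U`, continuity and the sup bound from a level-`m ≥ 2`
  reading), and **the pairing identity** `AtLevel.inner_evalElem`:
  `⟪F, evalElem m i x⟫ = (physVel g (ξ(x)))ᵢ` when `F` is `g` at level `m ≥ 4`.

Everything is proved; no named fact and no `sorry` is introduced.

## References

* L. Grafakos, *Classical Fourier Analysis*, 3rd ed., Prop. 3.3.12. [Grafakos2014]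
* T. Kato, C. Y. Lai, J. Funct. Anal. 56 (1984) 15–28. [KatoLai1984]
-/

noncomputable section

open MeasureTheory Set Function Filter Topology TopologicalSpace Finset
open scoped NNReal ENNReal InnerProductSpace RealInnerProductSpace ContDiff

namespace Literature.Analysis.FluidPDE

open FunctionSpaces FunctionSpaces.Torus UnitAddTorus

/-- Local notation for physical space `ℝ³ = EuclideanSpace ℝ (Fin 3)`. -/
local notation "ℝ³" => EuclideanSpace ℝ (Fin 3)

namespace PeriodicCylinder

/-! ### The two-mode element as a real-linear map of the coefficient -/

/-- The basis vector `δᵢ ∈ ℂ³`. [folklore] -/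
abbrev cδ (i : Fin 3) : EuclideanSpace ℂ (Fin 3) := EuclideanSpace.single i (1 : ℂ)

/-- `conjVec (z • δᵢ) = conj z • δᵢ`. [folklore] -/
theorem conjVec_smul_cδ (z : ℂ) (i : Fin 3) : EuclideanSpace.conjVec (z • cδ i) = (starRingEnd ℂ z) • cδ i := by
  rw [EuclideanSpace.conjVec_smul]
  congr 1
  ext j
  rw [EuclideanSpace.conjVec_apply]
  by_cases h : j = i
  · subst h; simp
  · simp [h]

/-- The two-mode element as a function of the coefficient. [folklore] -/
def pairFun (i : Fin 3) (k : Fin 3 → ℤ) (z : ℂ) : SymL2 (Fin 3) := SymL2.symSingle k (z • cδ i)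

/-- Coordinates of the two-mode element. [folklore] -/
theorem pairFun_apply (i : Fin 3) (k : Fin 3 → ℤ) (z : ℂ) (l : Fin 3 → ℤ) :
    pairFun i k z l = (if l = k then z • cδ i else 0) + (if l = -k then (starRingEnd ℂ z) • cδ i else 0) := by
  rw [pairFun, SymL2.symSingle, SymL2.ofFinSupp_apply, SymL2.symSingleFun, conjVec_smul_cδ]

/-- Additivity in the coefficient. [folklore] -/
theorem pairFun_add (i : Fin 3) (k : Fin 3 → ℤ) (z z' : ℂ) : pairFun i k (z + z') = pairFun i k z + pairFun i k z' := by
  refine SymL2.ext fun l => ?_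
  simp only [SymL2.add_apply, pairFun_apply, map_add, add_smul]
  split_ifs <;> simp only [add_zero, zero_add, add_add_add_comm]

/-- Real homogeneity in the coefficient. [folklore] -/
theorem pairFun_smul (i : Fin 3) (k : Fin 3 → ℤ) (c : ℝ) (z : ℂ) : pairFun i k (c • z) = c • pairFun i k z := by
  refine SymL2.ext fun l => ?_
  rw [SymL2.smul_apply, pairFun_apply, pairFun_apply, smul_add]
  congr 1
  · split_ifs
    · rw [smul_smul, Complex.real_smul]
    · rw [smul_zero]
  · split_ifs
    · rw [smul_smul, Complex.real_smul, map_mul, Complex.conj_ofReal]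
    · rw [smul_zero]

/-- The norm bound `‖pairFun i k z‖ ≤ 2 ‖z‖`. [folklore] -/
theorem norm_pairFun_le (i : Fin 3) (k : Fin 3 → ℤ) (z : ℂ) : ‖pairFun i k z‖ ≤ 2 * ‖z‖ := by
  have hs := SymL2.hasSum_norm_sq (pairFun i k z)
  -- every coordinate has norm at most `2 ‖z‖`, and only `k, -k` are non-zero
  have hcoord : ∀ l, ‖pairFun i k z l‖ ≤ (if l = k then ‖z‖ else 0) + (if l = -k then ‖z‖ else 0) := by
    intro l
    rw [pairFun_apply]
    refine (norm_add_le _ _).trans (add_le_add ?_ ?_)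
    · split_ifs
      · rw [norm_smul, PiLp.norm_single, norm_one, mul_one]
      · rw [norm_zero]
    · split_ifs
      · rw [norm_smul, PiLp.norm_single, norm_one, mul_one, Complex.norm_conj]
      · rw [norm_zero]
  have hsq : ‖pairFun i k z‖ ^ 2 ≤ (2 * ‖z‖) ^ 2 := by
    have hbound : ∀ l, ‖pairFun i k z l‖ ^ 2 ≤ (if l = k then 2 * ‖z‖ ^ 2 else 0) + (if l = -k then 2 * ‖z‖ ^ 2 else 0) := by
      intro l
      have h := hcoord l
      have hz := norm_nonneg z
      have hn := norm_nonneg (pairFun i k z l)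
      split_ifs at h ⊢ <;> nlinarith
    have hsum2 : HasSum (fun l : Fin 3 → ℤ => (if l = k then 2 * ‖z‖ ^ 2 else 0) + (if l = -k then 2 * ‖z‖ ^ 2 else 0))
        (2 * ‖z‖ ^ 2 + 2 * ‖z‖ ^ 2) := (hasSum_ite_eq k _).add (hasSum_ite_eq (-k) _)
    have := hasSum_le hbound hs hsum2
    nlinarith
  exact (pow_le_pow_iff_left₀ (norm_nonneg _) (by positivity) two_ne_zero).1 hsq

/-- **The two-mode element as a continuous real-linear map of the coefficient.** [folklore] -/
def pairCLM (i : Fin 3) (k : Fin 3 → ℤ) : ℂ →L[ℝ] SymL2 (Fin 3) :=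
  LinearMap.mkContinuous { toFun := pairFun i k, map_add' := pairFun_add i k, map_smul' := pairFun_smul i k } 2
    (norm_pairFun_le i k)

/-- Unfolding. [folklore] -/
theorem pairCLM_apply (i : Fin 3) (k : Fin 3 → ℤ) (z : ℂ) : pairCLM i k z = pairFun i k z := rfl

/-- `‖pairCLM i k‖ ≤ 2`. [folklore] -/
theorem norm_pairCLM_le (i : Fin 3) (k : Fin 3 → ℤ) : ‖pairCLM i k‖ ≤ 2 :=
  LinearMap.mkContinuous_norm_le _ (by norm_num) _

/-! ### The lifted characters on physical space -/

section Char

variable (L : ℝ)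

/-- The torus point of `x ∈ ℝ³`. [folklore] -/
def torusPt (x : ℝ³) : UnitAddTorus (Fin 3) := proj (boxInv L x)

/-- `fromTorus V x = V (torusPt x)`. [folklore] -/
theorem fromTorus_eq_torusPt (V : UnitAddTorus (Fin 3) → ℝ³) (x : ℝ³) : fromTorus L V x = V (torusPt L x) := rfl

/-- **The lifted character** `e_{-k}(ξ(x))`. [folklore] -/
def charFn (k : Fin 3 → ℤ) (x : ℝ³) : ℂ := mFourier (-k) (torusPt L x)

/-- The lifted character factors through the affine box map. [folklore] -/
theorem charFn_eq (k : Fin 3 → ℤ) :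
    charFn L k = fun x => (fun y : ℝ³ => mFourier (-k) (proj y)) (boxInvLin L x + WithLp.toLp 2 fun i => -((boxSide L i)⁻¹ * boxOff i)) := by
  funext x
  rw [charFn, torusPt, boxInv_eq L x]

/-- The lifted character is smooth. [folklore] -/
theorem contDiff_charFn (k : Fin 3 → ℤ) {n : ℕ∞} : ContDiff ℝ n (charFn L k) := by
  rw [charFn_eq]
  have h := (isSmooth_mFourier_smul (d := Fin 3) (-k) (1 : ℂ))
  have h1 : ContDiff ℝ ∞ (fun y : ℝ³ => mFourier (-k) (proj y)) := by
    have : (fun y : ℝ³ => mFourier (-k) (proj y)) = fun y => mFourier (-k) (proj y) • (1 : ℂ) := by funext y; simp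
    rw [this]; exact h
  exact (h1.of_le (by exact_mod_cast le_top)).comp ((boxInvLin L).contDiff.add contDiff_const)

/-- **Derivative bounds of the lifted characters**: `‖Dʲ charFn k x‖ ≤ (2π(1+|k|²))ʲ ‖a⁻¹‖ʲ`. [folklore] -/
theorem norm_iteratedFDeriv_charFn_le (k : Fin 3 → ℤ) (j : ℕ) (x : ℝ³) :
    ‖iteratedFDeriv ℝ j (charFn L k) x‖ ≤ (2 * Real.pi * (1 + freqNormSq k)) ^ j * ‖(boxInvLin L : ℝ³ →L[ℝ] ℝ³)‖ ^ j := by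
  rw [charFn_eq]
  have h1 : ContDiff ℝ ∞ (fun y : ℝ³ => mFourier (-k) (proj y)) := by
    have : (fun y : ℝ³ => mFourier (-k) (proj y)) = fun y => mFourier (-k) (proj y) • (1 : ℂ) := by funext y; simp
    rw [this]; exact isSmooth_mFourier_smul (d := Fin 3) (-k) (1 : ℂ)
  refine (Calculus.norm_iteratedFDeriv_comp_affine_le (N := ∞) h1 (boxInvLin L) _ (by exact_mod_cast le_top) x).trans ?_
  refine mul_le_mul_of_nonneg_right ?_ (by positivity)
  have h := Torus.norm_iteratedFDeriv_mFourier_proj_le (d := Fin 3) (-k) j (boxInvLin L x + WithLp.toLp 2 fun i => -((boxSide L i)⁻¹ * boxOff i))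
  rwa [freqNormSq_neg] at h

end Char

/-! ### The evaluation element -/

section Eval

variable (L : ℝ) (m : ℕ) (i : Fin 3)

/-- The `k`-th term of the evaluation element. [folklore] -/
def evalTerm (k : Fin 3 → ℤ) (x : ℝ³) : SymL2 (Fin 3) := pairCLM i k (((wt m k)⁻¹ : ℝ) • charFn L k x)

/-- Each term is smooth. [folklore] -/
theorem contDiff_evalTerm (k : Fin 3 → ℤ) {n : ℕ∞} : ContDiff ℝ n (evalTerm L m i k) :=
  (pairCLM i k).contDiff.comp ((contDiff_charFn L k).const_smul _)

/-- **Derivative bounds of the terms**: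
`‖Dʲ evalTerm k x‖ ≤ 2 (wt m k)⁻¹ (2π(1+|k|²))ʲ ‖a⁻¹‖ʲ`. [folklore] -/
theorem norm_iteratedFDeriv_evalTerm_le (k : Fin 3 → ℤ) (j : ℕ) (x : ℝ³) :
    ‖iteratedFDeriv ℝ j (evalTerm L m i k) x‖ ≤
      2 * (wt m k)⁻¹ * ((2 * Real.pi * (1 + freqNormSq k)) ^ j * ‖(boxInvLin L : ℝ³ →L[ℝ] ℝ³)‖ ^ j) := by
  have hc : ContDiff ℝ ∞ (((wt m k)⁻¹ : ℝ) • charFn L k) := contDiff_const.smul (contDiff_charFn L k)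
  have h1 : ‖iteratedFDeriv ℝ j (evalTerm L m i k) x‖ ≤ ‖pairCLM i k‖ * ‖iteratedFDeriv ℝ j (((wt m k)⁻¹ : ℝ) • charFn L k) x‖ :=
    (pairCLM i k).norm_iteratedFDeriv_comp_left hc.contDiffAt (by exact_mod_cast le_top)
  have hcj : ContDiffAt ℝ j (charFn L k) x := ((contDiff_charFn L k (n := (⊤ : ℕ∞))).of_le (by exact_mod_cast le_top)).contDiffAt
  have h2 : iteratedFDeriv ℝ j (((wt m k)⁻¹ : ℝ) • charFn L k) x = ((wt m k)⁻¹ : ℝ) • iteratedFDeriv ℝ j (charFn L k) x :=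
    iteratedFDeriv_const_smul_apply hcj
  rw [h2, norm_smul, Real.norm_of_nonneg (inv_pos.2 (wt_pos m k)).le] at h1
  have h3 := norm_iteratedFDeriv_charFn_le L k j x
  have hw : 0 ≤ (wt m k)⁻¹ := (inv_pos.2 (wt_pos m k)).le
  calc _ ≤ ‖pairCLM i k‖ * ((wt m k)⁻¹ * ‖iteratedFDeriv ℝ j (charFn L k) x‖) := h1
    _ ≤ 2 * ((wt m k)⁻¹ * ((2 * Real.pi * (1 + freqNormSq k)) ^ j * ‖(boxInvLin L : ℝ³ →L[ℝ] ℝ³)‖ ^ j)) :=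
        mul_le_mul (norm_pairCLM_le i k) (mul_le_mul_of_nonneg_left h3 hw) (by positivity) (by norm_num)
    _ = _ := by ring

/-- **Summability of the bounds**: `∑ₖ (wt m k)⁻¹ (1+|k|²)ʲ < ∞` for `2j + 4 ≤ m`. [folklore] -/
theorem summable_wt_inv_mul_pow {j : ℕ} (hjm : 2 * j + 4 ≤ m) :
    Summable fun k : Fin 3 → ℤ => (wt m k)⁻¹ * (1 + freqNormSq k) ^ j := by
  have h := summable_one_add_freqNormSq_rpow_neg_of_lt (d := Fin 3) (s := 2) (by norm_num)
  refine h.of_nonneg_of_le (fun k => mul_nonneg (inv_pos.2 (wt_pos m k)).le (pow_nonneg (by linarith [freqNormSq_nonneg k]) j)) fun k => ?_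
  have hk1 : (1 : ℝ) ≤ 1 + freqNormSq k := by linarith [freqNormSq_nonneg k]
  have hk0 : (0 : ℝ) < 1 + freqNormSq k := by linarith
  have hw := wt_pos m k
  rw [Real.rpow_neg hk0.le, show (2 : ℝ) = ((2 : ℕ) : ℝ) by norm_num, Real.rpow_natCast, inv_mul_le_iff₀ hw,
    ← div_eq_mul_inv, le_div_iff₀ (pow_pos hk0 2), ← pow_add]
  -- `(1+|k|²)^{j+2} ≤ wt m k = √((1+|k|²)^m)`
  rw [wt, Real.le_sqrt (pow_nonneg hk0.le _) (pow_nonneg hk0.le _), ← pow_mul]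
  exact pow_le_pow_right₀ hk1 (by omega)

/-- The bound family of `contDiff_tsum`. [folklore] -/
theorem summable_evalTerm_bound {j : ℕ} (hjm : 2 * j + 4 ≤ m) :
    Summable fun k : Fin 3 → ℤ => 2 * (wt m k)⁻¹ * ((2 * Real.pi * (1 + freqNormSq k)) ^ j * ‖(boxInvLin L : ℝ³ →L[ℝ] ℝ³)‖ ^ j) := by
  have h := (summable_wt_inv_mul_pow m hjm).mul_left (2 * ((2 * Real.pi) ^ j * ‖(boxInvLin L : ℝ³ →L[ℝ] ℝ³)‖ ^ j))
  refine h.congr fun k => ?_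
  simp only [mul_pow]; ring

/-- **The evaluation element** `E(x) = ½ ∑ₖ evalTerm k x`. [cite: Grafakos2014, Prop. 3.3.12] -/
def evalElem (x : ℝ³) : SymL2 (Fin 3) := (2 : ℝ)⁻¹ • ∑' k, evalTerm L m i k x

/-- **The evaluation element is `C^n` in `x` for `2n + 4 ≤ m`.** [cite: Grafakos2014, Prop. 3.3.12] -/
theorem contDiff_evalElem {n : ℕ} (hnm : 2 * n + 4 ≤ m) : ContDiff ℝ n (evalElem L m i) := by
  unfold evalElem
  refine ContDiff.const_smul _ ?_
  refine contDiff_tsum (fun k => contDiff_evalTerm L m i k) (fun j hj => summable_evalTerm_bound L m (j := j) ?_) (fun j k x hj => ?_)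
  · have : j ≤ n := by exact_mod_cast hj
    omega
  · exact norm_iteratedFDeriv_evalTerm_le L m i k j x

/-- The terms are summable (`m ≥ 4`). [folklore] -/
theorem summable_evalTerm (hm : 4 ≤ m) (x : ℝ³) : Summable fun k => evalTerm L m i k x := by
  refine Summable.of_norm_bounded (summable_evalTerm_bound L m (j := 0) (by omega)) fun k => ?_
  have h := norm_iteratedFDeriv_evalTerm_le L m i k 0 x
  rwa [norm_iteratedFDeriv_zero] at h

/-- The coordinate map `X →L[ℝ] ℂ³`. [folklore] -/
def coordL (l : Fin 3 → ℤ) : SymL2 (Fin 3) →L[ℝ] EuclideanSpace ℂ (Fin 3) :=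
  LinearMap.mkContinuous { toFun := fun f => f l, map_add' := fun f g => SymL2.add_apply f g l, map_smul' := fun c f => SymL2.smul_apply c f l } 1
    fun f => by rw [one_mul]; exact SymL2.norm_apply_le f l

/-- Unfolding. [folklore] -/
theorem coordL_apply (l : Fin 3 → ℤ) (f : SymL2 (Fin 3)) : coordL l f = f l := rfl

/-- Coordinates of the terms. [folklore] -/
theorem evalTerm_apply (k : Fin 3 → ℤ) (x : ℝ³) (l : Fin 3 → ℤ) :
    evalTerm L m i k x l = (if l = k then (((wt m k)⁻¹ : ℝ) : ℂ) • (charFn L k x • cδ i) else 0) +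
      (if l = -k then (((wt m k)⁻¹ : ℝ) : ℂ) • ((starRingEnd ℂ (charFn L k x)) • cδ i) else 0) := by
  rw [evalTerm, pairCLM_apply, pairFun_apply]
  congr 1
  · split_ifs
    · rw [Complex.real_smul, smul_smul]
    · rfl
  · split_ifs
    · rw [Complex.real_smul, map_mul, Complex.conj_ofReal, smul_smul]
    · rfl

/-- The conjugate of `e_{-k}(ξ)` is `e_{k}(ξ) = e_{-(-k)}(ξ)`. [folklore] -/
theorem conj_charFn (k : Fin 3 → ℤ) (x : ℝ³) : starRingEnd ℂ (charFn L k x) = charFn L (-k) x := by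
  rw [charFn, charFn, neg_neg, mFourier_neg, starRingEnd_self_apply]

/-- **The coordinates of the evaluation element**: `E(x) l = (wt m l)⁻¹ e_{-l}(ξ(x)) • δᵢ`. [folklore] -/
theorem evalElem_apply (hm : 4 ≤ m) (x : ℝ³) (l : Fin 3 → ℤ) :
    evalElem L m i x l = (((wt m l)⁻¹ : ℝ) : ℂ) • (charFn L l x • cδ i) := by
  classical
  rw [evalElem, SymL2.smul_apply]
  have hsum := summable_evalTerm L m i hm x
  have ht : (∑' k, evalTerm L m i k x) l = ∑' k, evalTerm L m i k x l := by
    rw [← coordL_apply, (coordL l).map_tsum hsum]; rfl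
  rw [ht]
  set v : EuclideanSpace ℂ (Fin 3) := (((wt m l)⁻¹ : ℝ) : ℂ) • (charFn L l x • cδ i) with hv
  have hsupp : ∀ k ∉ ({l, -l} : Finset (Fin 3 → ℤ)), evalTerm L m i k x l = 0 := by
    intro k hk
    simp only [Finset.mem_insert, Finset.mem_singleton, not_or] at hk
    rw [evalTerm_apply, if_neg (fun h => hk.1 h.symm), if_neg (fun h => hk.2 (by rw [h, neg_neg])), add_zero]
  rw [tsum_eq_sum hsupp]
  -- the two possibly non-zero terms
  have hTl : evalTerm L m i l x l = v + (if l = -l then v else 0) := by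
    rw [evalTerm_apply, if_pos rfl]
    congr 1
    split_ifs with h
    · rw [hv, conj_charFn, show -l = l from h.symm]
    · rfl
  have hTnl : evalTerm L m i (-l) x l = (if l = -l then v else 0) + v := by
    rw [evalTerm_apply, neg_neg, if_pos rfl, conj_charFn, neg_neg, wt_neg]
    congr 1
    split_ifs with h
    · rw [hv, ← h]
    · rfl
  have hfinal : ∑ k ∈ ({l, -l} : Finset (Fin 3 → ℤ)), evalTerm L m i k x l = (2 : ℂ) • v := by
    by_cases hl : l = -l
    · have hpair : ({l, -l} : Finset (Fin 3 → ℤ)) = {l} := by rw [← hl]; exact Finset.pair_eq_singleton l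
      rw [hpair, Finset.sum_singleton, hTl, if_pos hl, two_smul]
    · rw [Finset.sum_pair hl, hTl, hTnl, if_neg hl, add_zero, zero_add, two_smul]
  rw [hfinal, smul_smul, show (((2 : ℝ)⁻¹ : ℝ) : ℂ) * 2 = 1 by push_cast; norm_num, one_smul]

end Eval


/-! ### The physical field of an `L²`-level coefficient family -/

section Phys

variable {m : ℕ}

/-- `∑ₖ (wt m k)⁻² < ∞` for `m ≥ 2`. [folklore] -/
theorem summable_wt_inv_sq (hm : 2 ≤ m) : Summable fun k : Fin 3 → ℤ => (wt m k)⁻¹ ^ 2 := by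
  have h := summable_one_add_freqNormSq_rpow_neg_of_lt (d := Fin 3) (s := 2) (by norm_num)
  refine h.of_nonneg_of_le (fun k => sq_nonneg _) fun k => ?_
  have hk1 : (1 : ℝ) ≤ 1 + freqNormSq k := by linarith [freqNormSq_nonneg k]
  have hk0 : (0 : ℝ) < 1 + freqNormSq k := by linarith
  rw [inv_pow, wt_sq, Real.rpow_neg hk0.le, show (2 : ℝ) = ((2 : ℕ) : ℝ) by norm_num, Real.rpow_natCast]
  exact inv_anti₀ (pow_pos hk0 2) (pow_le_pow_right₀ hk1 hm)

/-- The physical coefficients of a level-`m` reading are the `L²`-level coefficients. [folklore] -/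
theorem AtLevel.coef_eq {g F : SymL2 (Fin 3)} (h : AtLevel m g F) (k : Fin 3 → ℤ) : SymL2.coef (wt m) F k = g k := by
  rw [SymL2.coef_apply, h k, smul_smul]
  have hw : ((wt m k : ℝ) : ℂ) ≠ 0 := by exact_mod_cast (wt_pos m k).ne'
  rw [inv_mul_cancel₀ hw, one_smul]

/-- **Absolute summability of the coefficients** of a family with a level-`m` reading, `m ≥ 2`.
[folklore] -/
theorem AtLevel.summable_norm (hm : 2 ≤ m) {g F : SymL2 (Fin 3)} (h : AtLevel m g F) : Summable fun k => ‖g k‖ :=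
  (SymL2.summable_norm_coef (isWeight_wt m) (summable_wt_inv_sq hm) F).1.congr fun k => by rw [h.coef_eq]

/-- **The physical field** `Re ∑ₖ e_k(ξ) g k` of an `L²`-level coefficient family.
[cite: Grafakos2014, §3.3.3] -/
def physVel (g : SymL2 (Fin 3)) (ξ : UnitAddTorus (Fin 3)) : ℝ³ := EuclideanSpace.realPart (∑' k, mFourier k ξ • g k)

/-- The synthesized field of a level-`m` reading is the physical field. [folklore] -/
theorem AtLevel.field_eq {g F : SymL2 (Fin 3)} (h : AtLevel m g F) : SymL2.field (wt m) F = physVel g := by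
  funext ξ
  rw [SymL2.field_apply, physVel]
  congr 1
  exact tsum_congr fun k => by rw [h.coef_eq]

/-- At the unit weight the synthesized field is the physical field. [folklore] -/
theorem field_one_eq_physVel (g : SymL2 (Fin 3)) : SymL2.field (fun _ => (1 : ℝ)) g = physVel g := by
  funext ξ
  rw [SymL2.field_apply, physVel]
  congr 1
  exact tsum_congr fun k => by rw [SymL2.coef_apply]; simp

/-- **The physical field of `toL2 U` is `U`** for smooth `U`. [folklore] -/
theorem physVel_toL2 {U : UnitAddTorus (Fin 3) → ℝ³} (hU : IsSmooth U) : physVel (toL2 hU) = U := by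
  rw [← field_one_eq_physVel]
  exact SymL2.field_ofSmooth isWeight_one polyGrowth_one hU

/-- **Continuity** of the physical field of a family with a level-`m ≥ 2` reading. [folklore] -/
theorem AtLevel.continuous_physVel (hm : 2 ≤ m) {g F : SymL2 (Fin 3)} (h : AtLevel m g F) : Continuous (physVel g) := by
  rw [← h.field_eq]; exact SymL2.continuous_field (isWeight_wt m) (summable_wt_inv_sq hm) F

/-- **Sup bound** `‖physVel g ξ‖ ≤ (∑ wt⁻²)^{1/2} ‖F‖`. [folklore] -/
theorem AtLevel.norm_physVel_le (hm : 2 ≤ m) {g F : SymL2 (Fin 3)} (h : AtLevel m g F) (ξ : UnitAddTorus (Fin 3)) :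
    ‖physVel g ξ‖ ≤ Real.sqrt (∑' k, (wt m k)⁻¹ ^ 2) * ‖F‖ := by
  rw [← h.field_eq]; exact SymL2.norm_field_le (isWeight_wt m) (summable_wt_inv_sq hm) F ξ

/-- Differences of physical fields. [folklore] -/
theorem AtLevel.physVel_sub (hm : 2 ≤ m) {g g' F F' : SymL2 (Fin 3)} (h : AtLevel m g F) (h' : AtLevel m g' F') :
    physVel (g - g') = physVel g - physVel g' := by
  rw [← (h.sub h').field_eq, SymL2.field_sub (isWeight_wt m) (summable_wt_inv_sq hm), h.field_eq, h'.field_eq]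

/-- The termwise identity of the pairing: `Re⟪F k, wt⁻¹ e_{-k}(ξ) δᵢ⟫ = Re(e_k(ξ) (g k)ᵢ)`. [folklore] -/
theorem AtLevel.re_inner_term {g F : SymL2 (Fin 3)} (h : AtLevel m g F) (i : Fin 3) (ξ : UnitAddTorus (Fin 3)) (k : Fin 3 → ℤ) :
    RCLike.re ⟪F k, (((wt m k)⁻¹ : ℝ) : ℂ) • (mFourier (-k) ξ • cδ i)⟫_ℂ = (mFourier k ξ * g k i).re := by
  have hF : F k i = ((wt m k : ℝ) : ℂ) * g k i := by rw [h k, PiLp.smul_apply, smul_eq_mul]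
  have h1 : ⟪F k, (((wt m k)⁻¹ : ℝ) : ℂ) • (mFourier (-k) ξ • cδ i)⟫_ℂ =
      (((wt m k)⁻¹ : ℝ) : ℂ) * (mFourier (-k) ξ * starRingEnd ℂ (F k i)) := by
    rw [inner_smul_right, inner_smul_right, EuclideanSpace.inner_single_right, one_mul]
  have hw : ((wt m k : ℝ) : ℂ) ≠ 0 := by exact_mod_cast (wt_pos m k).ne'
  have h2 : (((wt m k)⁻¹ : ℝ) : ℂ) * (mFourier (-k) ξ * starRingEnd ℂ (F k i)) = starRingEnd ℂ (mFourier k ξ * g k i) := by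
    rw [hF, map_mul (starRingEnd ℂ), map_mul (starRingEnd ℂ), Complex.conj_ofReal, mFourier_neg]
    push_cast
    field_simp
  rw [h1, h2, RCLike.re_to_complex, Complex.conj_re]

/-- The coordinates of the physical field as series: `(physVel g ξ)ᵢ = ∑ₖ Re(e_k(ξ) (g k)ᵢ)`. [folklore] -/
theorem AtLevel.physVel_apply_eq_tsum (hm : 2 ≤ m) {g F : SymL2 (Fin 3)} (h : AtLevel m g F) (i : Fin 3) (ξ : UnitAddTorus (Fin 3)) :
    physVel g ξ i = ∑' k, (mFourier k ξ * g k i).re := by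
  have hsum := h.summable_norm hm
  have hs1 : Summable fun k => mFourier k ξ • g k :=
    .of_norm (hsum.congr fun k => by rw [norm_smul, norm_mFourier_apply, one_mul])
  have hs3 : Summable fun k => mFourier k ξ * g k i := by
    have := (EuclideanSpace.proj (𝕜 := ℂ) i).summable hs1
    simpa only [EuclideanSpace.coe_proj, PiLp.smul_apply, smul_eq_mul] using this
  have h4 : EuclideanSpace.proj (𝕜 := ℂ) i (∑' k, mFourier k ξ • g k) = ∑' k, EuclideanSpace.proj (𝕜 := ℂ) i (mFourier k ξ • g k) :=
    ContinuousLinearMap.map_tsum _ hs1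
  simp only [EuclideanSpace.coe_proj, PiLp.smul_apply, smul_eq_mul] at h4
  have h5 : Complex.reCLM (∑' k, mFourier k ξ * g k i) = ∑' k, Complex.reCLM (mFourier k ξ * g k i) :=
    ContinuousLinearMap.map_tsum _ hs3
  simp only [Complex.reCLM_apply] at h5
  rw [physVel, EuclideanSpace.realPart_apply, h4, h5]

/-- **The pairing identity**: `⟪F, evalElem L m i x⟫ = (physVel g (ξ(x)))ᵢ` when `F` is `g` at
level `m ≥ 4`. [cite: Grafakos2014, Prop. 3.3.12] -/
theorem AtLevel.inner_evalElem (L : ℝ) (hm : 4 ≤ m) {g F : SymL2 (Fin 3)} (h : AtLevel m g F) (i : Fin 3) (x : ℝ³) :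
    ⟪F, evalElem L m i x⟫_ℝ = physVel g (torusPt L x) i := by
  rw [← (SymL2.hasSum_inner F (evalElem L m i x)).tsum_eq, h.physVel_apply_eq_tsum (by omega)]
  exact tsum_congr fun k => by rw [evalElem_apply L m i hm x k, charFn, h.re_inner_term]

end Phys

end PeriodicCylinder

end Literature.Analysis.FluidPDE
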